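import Literature.Probability.RandomMatrixProducts.AndersonModel1DSmoothing
import Mathlib.MeasureTheory.Function.SpecialFunctions.Basic
import HarnessLib

/-!
# Large deviations for the Anderson transfer matrices: the matrix-norm LDT from the vectorwise LDT, and the elementary inputs of §3

Companion to `AndersonModel1D.lean` (Bucaj–Damanik–Fillman–Gerbuz–VandenBoom–Wang–Zhang,
*Localization for the one-dimensional Anderson model via positivity and large deviations for the
Lyapunov exponent*, TAMS **372** (2019) 3619–3667, arXiv:1706.06135, §3).  Everything here is
PROVED.

The uniform large-deviation theorem for `‖M_n^E‖` (Thm 3.1 there, vendored as the named fact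
`BucajEtAl2019_matrixLDT`) is deduced in the source (§3, "Proof of Theorem 3.1", right after the
proof of Prop. 3.6) from the vectorwise uniform LDT (Prop. 3.6 there, the named fact
`BucajEtAl2019_vectorLDT`) by a half-page argument, which this file formalises verbatim:

* the lower deviation set is contained in the lower deviation set of the single vector `e₁`,
  because `‖M_n e₁‖ ≤ ‖M_n‖` (`andersonMatrixLDSet_subset_union`, first case);
* `‖M‖ ≤ √2 max_j ‖M e_j‖` (`log_norm_le_half_log_two_add_max`, from the Frobenius bound
  `norm_sq_le_frob`), so for `n ε ≥ log 2` the upper deviation set at level `ε` is contained in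
  the union of the two vector deviation sets at level `ε/2`;
* hence `μ^{⊗n}(B_n(E,ε)) ≤ 2 C(ε/2) e^{-η(ε/2) n}` for `n ≥ ⌈log 2/ε⌉`, and the finitely many small
  `n` are absorbed into the constant (`BucajEtAl2019_matrixLDT_of_vectorLDT`).

Consequently `BucajEtAl2019_matrixLDT_holds` will follow the moment `BucajEtAl2019_vectorLDT` is
discharged; the genuinely hard input (Prop. 3.6: Bougerol–Lacroix uniform convergence, Prop. 2.10,
and the block-independence argument) is NOT here.

Also recorded, all proved: measurability of the two large-deviation events, and the elementary
inputs of the proofs of Prop. 3.4 / Prop. 3.6 —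
* the energy part of Lemma 3.3 (`‖M_n^E - M_n^{E'}‖ ≤ n Γ^n |E - E'|`, by the shift
  `M^E(α) = M^{E'}(α + E' - E)` and the potential part `norm_andersonTransferProd_sub_le`), its
  vectorwise logarithmic form `|log ‖M_n^E v‖ - log ‖M_n^{E'} v‖| ≤ n |E - E'| Γ^{2n}`, and the
  resulting containment (3.11) / monotonicity in measure of the proof of Prop. 3.4
  (`measure_andersonVectorLDSet_le_of_energy`);
* the support box `|α| ≤ κ - 2` a.s. and the uniform bounds `0 ≤ L(E) ≤ log (2κ - 1)` on `Σ̂`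
  (displays (3.3)–(3.4), with `Γ ≤ 2κ - 1`);
* the Chebyshev count Lemma 3.5.
-/

noncomputable section

open MeasureTheory
open scoped Matrix.Norms.L2Operator ENNReal

namespace Literature.Probability.RandomMatrixProducts

/-! ### Columns of a unimodular `2 × 2` matrix -/

/-- `‖M e_j‖² = M_{0j}² + M_{1j}²` for the standard basis vector `e_j`. [folklore] -/
theorem norm_toEuclideanLin_single_sq (M : Matrix (Fin 2) (Fin 2) ℝ) (j : Fin 2) :
    ‖Matrix.toEuclideanLin M (EuclideanSpace.single j (1 : ℝ))‖ ^ 2 = M 0 j ^ 2 + M 1 j ^ 2 := by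
  have hns : ∀ u : EuclideanSpace ℝ (Fin 2), ‖u‖ ^ 2 = u 0 ^ 2 + u 1 ^ 2 := fun u => by
    rw [EuclideanSpace.norm_sq_eq]; simp [Fin.sum_univ_two]
  rw [hns, toEuclideanLin_apply_two, toEuclideanLin_apply_two]
  fin_cases j <;> simp

/-- The columns of a matrix of determinant `1` are non-zero: `0 < ‖M e_j‖`
(Lagrange: `1 = det² ≤ ‖M e₀‖² ‖M e₁‖²`). [folklore] -/
theorem norm_toEuclideanLin_single_pos (M : Matrix (Fin 2) (Fin 2) ℝ) (hM : M.det = 1) (j : Fin 2) :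
    0 < ‖Matrix.toEuclideanLin M (EuclideanSpace.single j (1 : ℝ))‖ := by
  have h0 := norm_toEuclideanLin_single_sq M 0
  have h1 := norm_toEuclideanLin_single_sq M 1
  rw [Matrix.det_fin_two] at hM
  have hlag : (1 : ℝ) ≤ ‖Matrix.toEuclideanLin M (EuclideanSpace.single 0 (1 : ℝ))‖ ^ 2 *
      ‖Matrix.toEuclideanLin M (EuclideanSpace.single 1 (1 : ℝ))‖ ^ 2 := by
    rw [h0, h1]
    nlinarith [sq_nonneg (M 0 0 * M 0 1 + M 1 0 * M 1 1)]
  refine (norm_nonneg _).lt_of_ne fun h => ?_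
  fin_cases j
  · simp only [Fin.zero_eta] at h
    rw [← h] at hlag; norm_num at hlag
  · simp only [Fin.mk_one] at h
    rw [← h] at hlag; norm_num at hlag

/-- `‖M e_j‖ ≤ ‖M‖`. [folklore] -/
theorem norm_toEuclideanLin_single_le (M : Matrix (Fin 2) (Fin 2) ℝ) (j : Fin 2) :
    ‖Matrix.toEuclideanLin M (EuclideanSpace.single j (1 : ℝ))‖ ≤ ‖M‖ := by
  simpa using norm_toEuclideanLin_apply_le M (EuclideanSpace.single j (1 : ℝ))

/-- **`‖M‖ ≤ √2 max_j ‖M e_j‖`** in logarithmic form, for `det M = 1`: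
`log ‖M‖ ≤ (log 2)/2 + max_j log ‖M e_j‖` (operator norm ≤ Frobenius norm).
[cite: BucajEtAl2019, §3 (proof of Thm 3.1, display `‖M_n‖ ≤ √2 max_j ‖M_n e_j‖`)] -/
theorem log_norm_le_half_log_two_add_max (M : Matrix (Fin 2) (Fin 2) ℝ) (hM : M.det = 1) :
    Real.log ‖M‖ ≤ Real.log 2 / 2 +
      max (Real.log ‖Matrix.toEuclideanLin M (EuclideanSpace.single 0 (1 : ℝ))‖)
        (Real.log ‖Matrix.toEuclideanLin M (EuclideanSpace.single 1 (1 : ℝ))‖) := by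
  set a₀ := ‖Matrix.toEuclideanLin M (EuclideanSpace.single 0 (1 : ℝ))‖ with ha₀_def
  set a₁ := ‖Matrix.toEuclideanLin M (EuclideanSpace.single 1 (1 : ℝ))‖ with ha₁_def
  have h0 : a₀ ^ 2 = M 0 0 ^ 2 + M 1 0 ^ 2 := norm_toEuclideanLin_single_sq M 0
  have h1 : a₁ ^ 2 = M 0 1 ^ 2 + M 1 1 ^ 2 := norm_toEuclideanLin_single_sq M 1
  have ha0 : 0 < a₀ := norm_toEuclideanLin_single_pos M hM 0
  have ha1 : 0 < a₁ := norm_toEuclideanLin_single_pos M hM 1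
  have hMpos : 0 < ‖M‖ := ha0.trans_le (norm_toEuclideanLin_single_le M 0)
  set m := max a₀ a₁ with hm_def
  have hm : 0 < m := lt_max_of_lt_left ha0
  have e0 : a₀ ≤ m := le_max_left _ _
  have e1 : a₁ ≤ m := le_max_right _ _
  have hfrob := norm_sq_le_frob M
  have hM2 : ‖M‖ ^ 2 ≤ 2 * m ^ 2 := by nlinarith [hfrob, h0, h1, e0, e1, ha0, ha1]
  have hlog2 : Real.log (‖M‖ ^ 2) ≤ Real.log (2 * m ^ 2) := Real.log_le_log (by positivity) hM2
  rw [Real.log_mul (by norm_num) (by positivity), Real.log_pow, Real.log_pow] at hlog2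
  push_cast at hlog2
  have hlogm : Real.log m ≤ max (Real.log a₀) (Real.log a₁) := by
    rcases le_total a₀ a₁ with h | h
    · rw [show m = a₁ from max_eq_right h]; exact le_max_right _ _
    · rw [show m = a₀ from max_eq_left h]; exact le_max_left _ _
  linarith

/-! ### The deviation events -/

/-- The vector large-deviation event is measurable. [folklore] -/
theorem measurableSet_andersonVectorLDSet (μ : Measure ℝ) (E ε : ℝ) (n : ℕ)
    (v : EuclideanSpace ℝ (Fin 2)) : MeasurableSet (andersonVectorLDSet μ E ε n v) := by
  unfold andersonVectorLDSet
  refine measurableSet_le measurable_const ?_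
  exact continuous_abs.measurable.comp
    ((((measurable_norm_andersonTransferProd_apply E n v).log).const_mul _).sub_const _)

/-- The matrix large-deviation event is measurable. [folklore] -/
theorem measurableSet_andersonMatrixLDSet (μ : Measure ℝ) (E ε : ℝ) (n : ℕ) :
    MeasurableSet (andersonMatrixLDSet μ E ε n) := by
  unfold andersonMatrixLDSet
  refine measurableSet_le measurable_const ?_
  have hc : Measurable fun α : Fin n → ℝ => ‖andersonTransferProd E (padSeq α) n‖ :=
    (continuous_andersonTransferProd E (n := n) n).norm.measurable
  exact continuous_abs.measurable.comp (((hc.log).const_mul _).sub_const _)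

/-- **The two containments of the proof of Thm 3.1**: for `n ε ≥ log 2`,
`{|n⁻¹ log ‖M_n‖ - L| ≥ ε} ⊆ {|n⁻¹ log ‖M_n e₀‖ - L| ≥ ε/2} ∪ {|n⁻¹ log ‖M_n e₁‖ - L| ≥ ε/2}`
(lower deviations: `‖M_n e₀‖ ≤ ‖M_n‖`; upper deviations: `‖M_n‖ ≤ √2 max_j ‖M_n e_j‖`).
[cite: BucajEtAl2019, §3 (proof of Thm 3.1)] -/
theorem andersonMatrixLDSet_subset_union (μ : Measure ℝ) (E : ℝ) {ε : ℝ} {n : ℕ} (hn : 1 ≤ n)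
    (hnε : Real.log 2 ≤ n * ε) :
    andersonMatrixLDSet μ E ε n ⊆
      andersonVectorLDSet μ E (ε / 2) n (EuclideanSpace.single 0 (1 : ℝ)) ∪
        andersonVectorLDSet μ E (ε / 2) n (EuclideanSpace.single 1 (1 : ℝ)) := by
  intro α hα
  simp only [andersonMatrixLDSet, Set.mem_setOf_eq] at hα
  simp only [andersonVectorLDSet, Set.mem_union, Set.mem_setOf_eq]
  set M := andersonTransferProd E (padSeq α) n with hM_def
  set L := andersonLyapunov μ E with hL_def
  set a₀ := ‖Matrix.toEuclideanLin M (EuclideanSpace.single 0 (1 : ℝ))‖ with ha₀_def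
  set a₁ := ‖Matrix.toEuclideanLin M (EuclideanSpace.single 1 (1 : ℝ))‖ with ha₁_def
  have hdet : M.det = 1 := det_andersonTransferProd E _ n
  have ha0 : 0 < a₀ := norm_toEuclideanLin_single_pos M hdet 0
  have hle0 : a₀ ≤ ‖M‖ := norm_toEuclideanLin_single_le M 0
  have hlog : Real.log ‖M‖ ≤ Real.log 2 / 2 + max (Real.log a₀) (Real.log a₁) :=
    log_norm_le_half_log_two_add_max M hdet
  have hnpos : (0 : ℝ) < n := by exact_mod_cast hn
  have hn_inv : (0 : ℝ) < 1 / (n : ℝ) := by positivity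
  have hε : 0 < ε := by
    have h2 : 0 < Real.log 2 := Real.log_pos (by norm_num)
    nlinarith
  have h2 : 1 / (n : ℝ) * (Real.log 2 / 2) ≤ ε / 2 := by
    have h2' : Real.log 2 / n ≤ ε := by rw [div_le_iff₀ hnpos, mul_comm]; exact hnε
    have : 1 / (n : ℝ) * (Real.log 2 / 2) = Real.log 2 / n / 2 := by ring
    rw [this]; linarith
  rcases le_abs'.mp hα with h | h
  · -- lower deviations: `‖M e₀‖ ≤ ‖M‖`
    left
    have hmono : 1 / (n : ℝ) * Real.log a₀ ≤ 1 / (n : ℝ) * Real.log ‖M‖ :=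
      mul_le_mul_of_nonneg_left (Real.log_le_log ha0 hle0) hn_inv.le
    rw [le_abs']; left; linarith
  · -- upper deviations: `‖M‖ ≤ √2 max_j ‖M e_j‖`
    rcases le_total (Real.log a₀) (Real.log a₁) with h01 | h10
    · right
      rw [max_eq_right h01] at hlog
      have h1 : 1 / (n : ℝ) * Real.log ‖M‖ ≤
          1 / (n : ℝ) * (Real.log 2 / 2) + 1 / (n : ℝ) * Real.log a₁ := by
        rw [← mul_add]; exact mul_le_mul_of_nonneg_left hlog hn_inv.le
      rw [le_abs']; right; linarith
    · left
      rw [max_eq_left h10] at hlog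
      have h1 : 1 / (n : ℝ) * Real.log ‖M‖ ≤
          1 / (n : ℝ) * (Real.log 2 / 2) + 1 / (n : ℝ) * Real.log a₀ := by
        rw [← mul_add]; exact mul_le_mul_of_nonneg_left hlog hn_inv.le
      rw [le_abs']; right; linarith

/-! ### Theorem 3.1 from Proposition 3.6 -/

/-- **Bucaj et al. Thm 3.1 from Prop. 3.6** (the source's own proof of Thm 3.1, §3): the
vectorwise uniform large-deviation theorem implies the uniform large-deviation theorem for the
matrix norms, with `η(ε) = η_vec(ε/2)` and `C(ε) = 2 C_vec(ε/2) + e^{η ⌈log 2/ε⌉}` (the second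
summand absorbing the finitely many `n < ⌈log 2/ε⌉`).
[cite: BucajEtAl2019, Thm 3.1 (its proof in §3, from Prop. 3.6)] -/
theorem BucajEtAl2019_matrixLDT_of_vectorLDT (h : BucajEtAl2019_vectorLDT) :
    BucajEtAl2019_matrixLDT := by
  intro μ _ hcpt hnt ε hε
  obtain ⟨C, η, hC, hη, hV⟩ := h μ hcpt hnt (ε / 2) (half_pos hε)
  set n₀ : ℕ := ⌈Real.log 2 / ε⌉₊ with hn₀_def
  refine ⟨2 * C + Real.exp (η * n₀), η, by positivity, hη, fun n hn E hE => ?_⟩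
  have hexp : 0 < Real.exp (-(η * n)) := Real.exp_pos _
  rcases le_or_gt n₀ n with hn₀ | hn₀
  · -- `n ≥ ⌈log 2/ε⌉`: the two containments and the vector LDT at level `ε/2`
    have hnε : Real.log 2 ≤ n * ε := by
      have h1 : Real.log 2 / ε ≤ n₀ := Nat.le_ceil _
      have h2 : (n₀ : ℝ) ≤ n := by exact_mod_cast hn₀
      rw [div_le_iff₀ hε] at h1
      nlinarith
    have e0 : ‖(EuclideanSpace.single 0 (1 : ℝ) : EuclideanSpace ℝ (Fin 2))‖ = 1 := by simp
    have e1 : ‖(EuclideanSpace.single 1 (1 : ℝ) : EuclideanSpace ℝ (Fin 2))‖ = 1 := by simp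
    calc (Measure.pi fun _ : Fin n => μ) (andersonMatrixLDSet μ E ε n)
        ≤ (Measure.pi fun _ : Fin n => μ)
            (andersonVectorLDSet μ E (ε / 2) n (EuclideanSpace.single 0 (1 : ℝ)) ∪
              andersonVectorLDSet μ E (ε / 2) n (EuclideanSpace.single 1 (1 : ℝ))) :=
          measure_mono (andersonMatrixLDSet_subset_union μ E hn hnε)
      _ ≤ (Measure.pi fun _ : Fin n => μ)
            (andersonVectorLDSet μ E (ε / 2) n (EuclideanSpace.single 0 (1 : ℝ))) +
          (Measure.pi fun _ : Fin n => μ)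
            (andersonVectorLDSet μ E (ε / 2) n (EuclideanSpace.single 1 (1 : ℝ))) :=
          measure_union_le _ _
      _ ≤ ENNReal.ofReal (C * Real.exp (-(η * n))) + ENNReal.ofReal (C * Real.exp (-(η * n))) :=
          add_le_add (hV n hn _ e0 E hE) (hV n hn _ e1 E hE)
      _ = ENNReal.ofReal (2 * C * Real.exp (-(η * n))) := by
          rw [← ENNReal.ofReal_add (by positivity) (by positivity)]; ring_nf
      _ ≤ ENNReal.ofReal ((2 * C + Real.exp (η * n₀)) * Real.exp (-(η * n))) :=
          ENNReal.ofReal_le_ofReal (by nlinarith [Real.exp_pos (η * n₀)])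
  · -- `n < ⌈log 2/ε⌉`: a probability is at most `1 ≤ e^{η (n₀ - n)}`
    have hone : 1 ≤ Real.exp (η * n₀) * Real.exp (-(η * n)) := by
      rw [← Real.exp_add]
      apply Real.one_le_exp
      have : (n : ℝ) < n₀ := by exact_mod_cast hn₀
      nlinarith
    calc (Measure.pi fun _ : Fin n => μ) (andersonMatrixLDSet μ E ε n) ≤ 1 := prob_le_one
      _ = ENNReal.ofReal 1 := ENNReal.ofReal_one.symm
      _ ≤ ENNReal.ofReal ((2 * C + Real.exp (η * n₀)) * Real.exp (-(η * n))) :=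
          ENNReal.ofReal_le_ofReal (by nlinarith [hC.le])

/-! ### Inputs of the proof of Prop. 3.6: the energy part of Lemma 3.3 and Lemma 3.5 -/

/-- `M^{E'}(α + (E' - E)) = M^E(α)`: the transfer matrix depends on `E - α` only. [folklore] -/
theorem andersonTransfer_energy_shift (E E' α : ℝ) :
    andersonTransfer E' (α + (E' - E)) = andersonTransfer E α := by
  ext i j
  fin_cases i <;> fin_cases j <;> simp [andersonTransfer]
  ring

/-- `M_n^{E'}(α + (E' - E)) = M_n^E(α)`. [folklore] -/
theorem andersonTransferProd_energy_shift (E E' : ℝ) (α : ℕ → ℝ) :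
    ∀ n, andersonTransferProd E' (fun k => α k + (E' - E)) n = andersonTransferProd E α n
  | 0 => rfl
  | n + 1 => by
    rw [andersonTransferProd_succ, andersonTransferProd_succ, andersonTransfer_energy_shift,
      andersonTransferProd_energy_shift E E' α n]

/-- **Perturbation in the energy** (the `E`-part of Bucaj et al. Lemma 3.3): if
`|E - α_k|, |E' - α_k| ≤ D` for `k < n` then `‖M_n^E(α) - M_n^{E'}(α)‖ ≤ n |E - E'| (D+1)^n`.
[cite: BucajEtAl2019, Lemma 3.3] -/
theorem norm_andersonTransferProd_sub_le_of_energy (E E' : ℝ) {D : ℝ} (hD : 0 ≤ D) (α : ℕ → ℝ)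
    (n : ℕ) (hE : ∀ k, k < n → |E - α k| ≤ D) (hE' : ∀ k, k < n → |E' - α k| ≤ D) :
    ‖andersonTransferProd E α n - andersonTransferProd E' α n‖ ≤ n * |E - E'| * (D + 1) ^ n := by
  rw [← andersonTransferProd_energy_shift E E' α n]
  refine norm_andersonTransferProd_sub_le E' hD (abs_nonneg _) _ _ n ?_ hE' ?_
  · intro k hk
    have : E' - (α k + (E' - E)) = E - α k := by ring
    rw [this]; exact hE k hk
  · intro k hk
    have : α k + (E' - E) - α k = -(E - E') := by ring
    rw [this, abs_neg]

/-- **Bucaj et al. Lemma 3.3** (joint perturbation in energy and potential): if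
`|E - α_k|, |E' - α_k|, |E' - β_k| ≤ D` and `|α_k - β_k| ≤ δ` for `k < n`, then
`‖M_n^E(α) - M_n^{E'}(β)‖ ≤ n (|E - E'| + δ) (D+1)^n` (the source has `Γ^{n-1}`, `Γ = D + 1`).
[cite: BucajEtAl2019, Lemma 3.3] -/
theorem norm_andersonTransferProd_sub_le_of_energy_of_potential (E E' : ℝ) {D δ : ℝ} (hD : 0 ≤ D)
    (hδ : 0 ≤ δ) (α β : ℕ → ℝ) (n : ℕ) (hEα : ∀ k, k < n → |E - α k| ≤ D)
    (hE'α : ∀ k, k < n → |E' - α k| ≤ D) (hE'β : ∀ k, k < n → |E' - β k| ≤ D)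
    (hd : ∀ k, k < n → |α k - β k| ≤ δ) :
    ‖andersonTransferProd E α n - andersonTransferProd E' β n‖ ≤
      n * (|E - E'| + δ) * (D + 1) ^ n := by
  have h1 := norm_andersonTransferProd_sub_le_of_energy E E' hD α n hEα hE'α
  have h2 := norm_andersonTransferProd_sub_le E' hD hδ α β n hE'α hE'β hd
  calc ‖andersonTransferProd E α n - andersonTransferProd E' β n‖
      = ‖(andersonTransferProd E α n - andersonTransferProd E' α n) +
          (andersonTransferProd E' α n - andersonTransferProd E' β n)‖ := by rw [sub_add_sub_cancel]
    _ ≤ ‖andersonTransferProd E α n - andersonTransferProd E' α n‖ +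
          ‖andersonTransferProd E' α n - andersonTransferProd E' β n‖ := norm_add_le _ _
    _ ≤ n * |E - E'| * (D + 1) ^ n + n * δ * (D + 1) ^ n := add_le_add h1 h2
    _ = n * (|E - E'| + δ) * (D + 1) ^ n := by ring

/-- **Bucaj et al. Lemma 3.5** (a discrete Chebyshev-type count): if `a_j ≤ B` on a finite index
set `s` and the average of the `a_j` over `s` is at least `L + ε`, then for every `δ` with
`B - L - δ > 0` the indices with `a_j > L + δ` number at least `#s · (ε - δ)/(B - L - δ)`.
[cite: BucajEtAl2019, Lemma 3.5] -/
theorem card_mul_le_card_filter_lt {ι : Type*} (s : Finset ι) (a : ι → ℝ) {B L ε δ : ℝ}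
    (hB : ∀ j ∈ s, a j ≤ B) (havg : (s.card : ℝ) * (L + ε) ≤ ∑ j ∈ s, a j)
    (hδ : 0 < B - L - δ) :
    (s.card : ℝ) * (ε - δ) / (B - L - δ) ≤ ((s.filter fun j => L + δ < a j).card : ℝ) := by
  classical
  have hsplit := Finset.sum_filter_add_sum_filter_not s (fun j => L + δ < a j) a
  have h1 : ∑ j ∈ s with L + δ < a j, a j ≤ ((s.filter fun j => L + δ < a j).card : ℝ) * B := by
    have := Finset.sum_le_card_nsmul (s.filter fun j => L + δ < a j) a B
      (fun j hj => hB j (Finset.mem_of_mem_filter j hj))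
    rwa [nsmul_eq_mul] at this
  have h2 : ∑ j ∈ s with ¬ (L + δ < a j), a j ≤
      ((s.filter fun j => ¬ (L + δ < a j)).card : ℝ) * (L + δ) := by
    have := Finset.sum_le_card_nsmul (s.filter fun j => ¬ (L + δ < a j)) a (L + δ)
      (fun j hj => not_lt.mp (Finset.mem_filter.mp hj).2)
    rwa [nsmul_eq_mul] at this
  have hcard : ((s.filter fun j => L + δ < a j).card : ℝ) +
      ((s.filter fun j => ¬ (L + δ < a j)).card : ℝ) = s.card := by
    exact_mod_cast Finset.card_filter_add_card_filter_not (s := s) (fun j => L + δ < a j)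
  rw [div_le_iff₀ hδ]
  have hnt : ((s.filter fun j => ¬ (L + δ < a j)).card : ℝ) =
      s.card - ((s.filter fun j => L + δ < a j).card : ℝ) := by linarith
  rw [hnt] at h2
  linear_combination havg + h1 + h2 - hsplit

/-! ### The support box `|α| ≤ κ - 2` and the uniform bounds `0 ≤ L(E) ≤ log Γ` on `Σ̂` -/

/-- On the support of the single-site law, `|α| ≤ κ - 2` (`κ = 2 + max_{𝒜} |α|`).
[cite: BucajEtAl2019, §3 (definition of `κ`)] -/
theorem abs_le_andersonKappa_sub_two {μ : Measure ℝ} (hcpt : IsCompact μ.support) {α : ℝ}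
    (hα : α ∈ μ.support) : |α| ≤ andersonKappa μ - 2 := by
  have hb : BddAbove ((fun a : ℝ => |a|) '' μ.support) := (hcpt.image continuous_abs).bddAbove
  have := le_csSup hb (Set.mem_image_of_mem (fun a : ℝ => |a|) hα)
  unfold andersonKappa
  linarith

/-- Almost every site potential satisfies `|α| ≤ κ - 2`.
[cite: BucajEtAl2019, §3 (definition of `κ`)] -/
theorem ae_abs_le_andersonKappa_sub_two (μ : Measure ℝ) (hcpt : IsCompact μ.support) :
    ∀ᵐ x ∂μ, |x| ≤ andersonKappa μ - 2 :=
  Filter.mem_of_superset Measure.support_mem_ae fun _ hx => abs_le_andersonKappa_sub_two hcpt hx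

/-- On `Σ̂ × (support box)`: `|E - α_k| ≤ 2κ - 2` for `k < n`, i.e. `Γ ≤ 2κ - 1`.
[cite: BucajEtAl2019, §3 (the constant `Γ`, display (3.3))] -/
theorem abs_energy_sub_padSeq_le {μ : Measure ℝ} {E : ℝ}
    (hE : E ∈ Set.Icc (-andersonKappa μ) (andersonKappa μ)) {n : ℕ} {x : Fin n → ℝ}
    (hx : ∀ i, |x i| ≤ andersonKappa μ - 2) :
    ∀ k, k < n → |E - padSeq x k| ≤ 2 * andersonKappa μ - 2 := fun k hk =>
  (abs_sub_padSeq_le hx E k hk).trans (by linarith [abs_le.mpr ⟨by linarith [hE.1], hE.2⟩])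

/-- `L(E) ≥ 0`. [cite: BucajEtAl2019, §2 (`L ≥ 0`)] -/
theorem andersonLyapunov_nonneg (μ : Measure ℝ) (E : ℝ) : 0 ≤ andersonLyapunov μ E :=
  le_ciInf fun n => andersonLogNormAvg_nonneg μ E (n + 1)

/-- **`n⁻¹ 𝔼 log ‖M_n^E‖ ≤ log Γ ≤ log (2κ - 1)` for `E ∈ Σ̂`** (`|F_n| ≤ log Γ`, display (3.3)).
[cite: BucajEtAl2019, §3 (display (3.3))] -/
theorem andersonLogNormAvg_le_log (μ : Measure ℝ) [IsProbabilityMeasure μ]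
    (hcpt : IsCompact μ.support) {E : ℝ} (hE : E ∈ Set.Icc (-andersonKappa μ) (andersonKappa μ))
    (n : ℕ) : andersonLogNormAvg μ E n ≤ Real.log (2 * andersonKappa μ - 1) := by
  have hκ := two_le_andersonKappa μ
  rcases Nat.eq_zero_or_pos n with rfl | hn
  · simp only [andersonLogNormAvg, Nat.cast_zero, div_zero, zero_mul]
    exact Real.log_nonneg (by linarith)
  set D := 2 * andersonKappa μ - 2 with hD_def
  have hD : 0 ≤ D := by linarith
  have hbox := ae_pi_abs_le (ae_abs_le_andersonKappa_sub_two μ hcpt) n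
  have hbound : ∀ᵐ α ∂(Measure.pi fun _ : Fin n => μ),
      Real.log ‖andersonTransferProd E (padSeq α) n‖ ≤ n * Real.log (D + 1) :=
    hbox.mono fun α hα => by
      have h1 := norm_andersonTransferProd_le E hD (padSeq α) n (abs_energy_sub_padSeq_le hE hα)
      have h2 : 1 ≤ ‖andersonTransferProd E (padSeq α) n‖ :=
        one_le_norm_of_det_eq_one _ (det_andersonTransferProd _ _ _)
      calc Real.log ‖andersonTransferProd E (padSeq α) n‖ ≤ Real.log ((D + 1) ^ n) :=
            Real.log_le_log (by linarith) h1
        _ = n * Real.log (D + 1) := Real.log_pow _ _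
  have hint : Integrable (fun α : Fin n → ℝ => Real.log ‖andersonTransferProd E (padSeq α) n‖)
      (Measure.pi fun _ : Fin n => μ) := by
    refine Integrable.mono' (integrable_const ((n : ℝ) * Real.log (D + 1))) ?_ ?_
    · exact (continuous_andersonTransferProd E n).norm.measurable.log.aestronglyMeasurable
    · filter_upwards [hbound] with α hα
      rw [Real.norm_eq_abs, abs_of_nonneg (log_norm_andersonTransferProd_nonneg E _ n)]
      exact hα
  have hI : ∫ α, Real.log ‖andersonTransferProd E (padSeq α) n‖ ∂(Measure.pi fun _ : Fin n => μ) ≤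
      n * Real.log (D + 1) := by
    calc ∫ α, Real.log ‖andersonTransferProd E (padSeq α) n‖ ∂(Measure.pi fun _ : Fin n => μ)
        ≤ ∫ _α, (n : ℝ) * Real.log (D + 1) ∂(Measure.pi fun _ : Fin n => μ) :=
          integral_mono_ae hint (integrable_const _) hbound
      _ = n * Real.log (D + 1) := by simp
  have hnpos : (0 : ℝ) < n := by exact_mod_cast hn
  unfold andersonLogNormAvg
  calc 1 / (n : ℝ) * ∫ α, Real.log ‖andersonTransferProd E (padSeq α) n‖ ∂(Measure.pi fun _ : Fin n => μ)
      ≤ 1 / (n : ℝ) * (n * Real.log (D + 1)) := mul_le_mul_of_nonneg_left hI (by positivity)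
    _ = Real.log (D + 1) := by field_simp
    _ = Real.log (2 * andersonKappa μ - 1) := by rw [hD_def]; ring_nf

/-- **`0 ≤ L(E) ≤ log (2κ - 1)` on `Σ̂`** (the upper half of display (3.4), `L(E) ≤ log Γ`).
[cite: BucajEtAl2019, §3 (display (3.4))] -/
theorem andersonLyapunov_le_log (μ : Measure ℝ) [IsProbabilityMeasure μ]
    (hcpt : IsCompact μ.support) {E : ℝ} (hE : E ∈ Set.Icc (-andersonKappa μ) (andersonKappa μ)) :
    andersonLyapunov μ E ≤ Real.log (2 * andersonKappa μ - 1) :=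
  (andersonLyapunov_le_logNormAvg μ E le_rfl).trans (andersonLogNormAvg_le_log μ hcpt hE 1)

/-! ### Perturbation in the energy for vectors and the containment (3.11) of Prop. 3.4 -/

/-- **Log-Lipschitz dependence on the energy, vectorwise**: if `|E - α_k|, |E' - α_k| ≤ D` for
`k < n` and `‖v‖ = 1` then `|log ‖M_n^E v‖ - log ‖M_n^{E'} v‖| ≤ n |E - E'| (D+1)^{2n}`
(Lemma 3.3 with the co-growth `‖M_n v‖ ≥ (D+1)^{-n}`).
[cite: BucajEtAl2019, Lemma 3.3 and Prop. 3.4 (proof)] -/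
theorem abs_log_norm_apply_sub_le_of_energy (E E' : ℝ) {D : ℝ} (hD : 0 ≤ D) (α : ℕ → ℝ) (n : ℕ)
    (hE : ∀ k, k < n → |E - α k| ≤ D) (hE' : ∀ k, k < n → |E' - α k| ≤ D)
    (v : EuclideanSpace ℝ (Fin 2)) (hv : ‖v‖ = 1) :
    |Real.log ‖Matrix.toEuclideanLin (andersonTransferProd E α n) v‖ -
        Real.log ‖Matrix.toEuclideanLin (andersonTransferProd E' α n) v‖| ≤
      n * |E - E'| * (D + 1) ^ (2 * n) := by
  set x := Matrix.toEuclideanLin (andersonTransferProd E α n) v with hx_def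
  set y := Matrix.toEuclideanLin (andersonTransferProd E' α n) v with hy_def
  have hc : 0 < ((D + 1) ^ n)⁻¹ := by positivity
  have hx : ((D + 1) ^ n)⁻¹ ≤ ‖x‖ := by
    have := (norm_andersonTransferProd_apply_bounds E hD α v n hE).2
    rw [hv] at this
    rw [inv_le_iff_one_le_mul₀ (by positivity), mul_comm]; exact this
  have hy : ((D + 1) ^ n)⁻¹ ≤ ‖y‖ := by
    have := (norm_andersonTransferProd_apply_bounds E' hD α v n hE').2
    rw [hv] at this
    rw [inv_le_iff_one_le_mul₀ (by positivity), mul_comm]; exact this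
  have hdiff : |‖x‖ - ‖y‖| ≤ n * |E - E'| * (D + 1) ^ n := by
    calc |‖x‖ - ‖y‖| ≤ ‖x - y‖ := abs_norm_sub_norm_le x y
      _ = ‖Matrix.toEuclideanLin (andersonTransferProd E α n - andersonTransferProd E' α n) v‖ := by
          rw [map_sub, LinearMap.sub_apply]
      _ ≤ ‖andersonTransferProd E α n - andersonTransferProd E' α n‖ * ‖v‖ :=
          norm_toEuclideanLin_apply_le _ _
      _ ≤ n * |E - E'| * (D + 1) ^ n * ‖v‖ :=
          mul_le_mul_of_nonneg_right (norm_andersonTransferProd_sub_le_of_energy E E' hD α n hE hE')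
            (norm_nonneg _)
      _ = n * |E - E'| * (D + 1) ^ n := by rw [hv, mul_one]
  calc |Real.log ‖x‖ - Real.log ‖y‖| ≤ |‖x‖ - ‖y‖| / ((D + 1) ^ n)⁻¹ := abs_log_sub_log_le hc hx hy
    _ ≤ n * |E - E'| * (D + 1) ^ n / ((D + 1) ^ n)⁻¹ := by gcongr
    _ = n * |E - E'| * (D + 1) ^ (2 * n) := by rw [div_inv_eq_mul]; ring

/-- **The containment (3.11) of the proof of Prop. 3.4**, on the support box `|α_i| ≤ R`: if
`|E| + R, |E'| + R ≤ D`, `|L(E) - L(E')| ≤ ε/4` and `|E - E'| (D+1)^{2n} ≤ ε/4`, then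
`{|n⁻¹ log ‖M_n^{E'} v‖ - L(E')| ≥ ε} ∩ box ⊆ {|n⁻¹ log ‖M_n^{E} v‖ - L(E)| ≥ ε/2}`.
[cite: BucajEtAl2019, Prop. 3.4 (proof, display (3.11))] -/
theorem andersonVectorLDSet_inter_box_subset (μ : Measure ℝ) {E E' ε R D : ℝ} (hR : 0 ≤ R)
    (hDE : |E| + R ≤ D) (hDE' : |E'| + R ≤ D) {n : ℕ} (hn : 1 ≤ n) (v : EuclideanSpace ℝ (Fin 2))
    (hv : ‖v‖ = 1) (hL : |andersonLyapunov μ E - andersonLyapunov μ E'| ≤ ε / 4)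
    (hρ : |E - E'| * (D + 1) ^ (2 * n) ≤ ε / 4) :
    andersonVectorLDSet μ E' ε n v ∩ {α | ∀ i, |α i| ≤ R} ⊆
      andersonVectorLDSet μ E (ε / 2) n v := by
  rintro α ⟨hα, hbox⟩
  simp only [andersonVectorLDSet, Set.mem_setOf_eq] at hα hbox ⊢
  have hD : 0 ≤ D := by linarith [abs_nonneg E]
  have hEk : ∀ k, k < n → |E - padSeq α k| ≤ D := fun k hk =>
    (abs_sub_padSeq_le hbox E k hk).trans hDE
  have hE'k : ∀ k, k < n → |E' - padSeq α k| ≤ D := fun k hk =>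
    (abs_sub_padSeq_le hbox E' k hk).trans hDE'
  have hlip := abs_log_norm_apply_sub_le_of_energy E E' hD (padSeq α) n hEk hE'k v hv
  have hnpos : (0 : ℝ) < n := by exact_mod_cast hn
  have hscaled : |1 / (n : ℝ) * Real.log ‖Matrix.toEuclideanLin (andersonTransferProd E (padSeq α) n) v‖ -
      1 / (n : ℝ) * Real.log ‖Matrix.toEuclideanLin (andersonTransferProd E' (padSeq α) n) v‖| ≤
      ε / 4 := by
    rw [← mul_sub, abs_mul, abs_of_pos (by positivity : (0 : ℝ) < 1 / n)]
    calc 1 / (n : ℝ) * _ ≤ 1 / (n : ℝ) * (n * |E - E'| * (D + 1) ^ (2 * n)) :=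
          mul_le_mul_of_nonneg_left hlip (by positivity)
      _ = |E - E'| * (D + 1) ^ (2 * n) := by field_simp
      _ ≤ ε / 4 := hρ
  -- triangle inequality
  have h1 := abs_sub_abs_le_abs_sub
    (1 / (n : ℝ) * Real.log ‖Matrix.toEuclideanLin (andersonTransferProd E' (padSeq α) n) v‖ -
      andersonLyapunov μ E')
    (1 / (n : ℝ) * Real.log ‖Matrix.toEuclideanLin (andersonTransferProd E (padSeq α) n) v‖ -
      andersonLyapunov μ E)
  have h2 : |(1 / (n : ℝ) * Real.log ‖Matrix.toEuclideanLin (andersonTransferProd E' (padSeq α) n) v‖ -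
      andersonLyapunov μ E') -
      (1 / (n : ℝ) * Real.log ‖Matrix.toEuclideanLin (andersonTransferProd E (padSeq α) n) v‖ -
      andersonLyapunov μ E)| ≤ ε / 4 + ε / 4 := by
    calc _ = |(1 / (n : ℝ) * Real.log ‖Matrix.toEuclideanLin (andersonTransferProd E' (padSeq α) n) v‖ -
          1 / (n : ℝ) * Real.log ‖Matrix.toEuclideanLin (andersonTransferProd E (padSeq α) n) v‖) +
          (andersonLyapunov μ E - andersonLyapunov μ E')| := by ring_nf
      _ ≤ |1 / (n : ℝ) * Real.log ‖Matrix.toEuclideanLin (andersonTransferProd E' (padSeq α) n) v‖ -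
          1 / (n : ℝ) * Real.log ‖Matrix.toEuclideanLin (andersonTransferProd E (padSeq α) n) v‖| +
          |andersonLyapunov μ E - andersonLyapunov μ E'| := abs_add_le _ _
      _ ≤ ε / 4 + ε / 4 := add_le_add (by rwa [abs_sub_comm]) hL
  linarith

/-- **Prop. 3.4's perturbation step in measure**: under the hypotheses of
`andersonVectorLDSet_inter_box_subset` and `|ω_0| ≤ R` a.s.,
`μ^{⊗n}{|n⁻¹ log ‖M_n^{E'} v‖ - L(E')| ≥ ε} ≤ μ^{⊗n}{|n⁻¹ log ‖M_n^{E} v‖ - L(E)| ≥ ε/2}`.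
[cite: BucajEtAl2019, Prop. 3.4 (proof)] -/
theorem measure_andersonVectorLDSet_le_of_energy (μ : Measure ℝ) [IsProbabilityMeasure μ]
    {E E' ε R D : ℝ} (hR : 0 ≤ R) (hRae : ∀ᵐ x ∂μ, |x| ≤ R) (hDE : |E| + R ≤ D)
    (hDE' : |E'| + R ≤ D)
    {n : ℕ} (hn : 1 ≤ n) (v : EuclideanSpace ℝ (Fin 2)) (hv : ‖v‖ = 1)
    (hL : |andersonLyapunov μ E - andersonLyapunov μ E'| ≤ ε / 4)
    (hρ : |E - E'| * (D + 1) ^ (2 * n) ≤ ε / 4) :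
    (Measure.pi fun _ : Fin n => μ) (andersonVectorLDSet μ E' ε n v) ≤
      (Measure.pi fun _ : Fin n => μ) (andersonVectorLDSet μ E (ε / 2) n v) := by
  have hbox : ∀ᵐ α ∂(Measure.pi fun _ : Fin n => μ), ∀ i, |α i| ≤ R := ae_pi_abs_le hRae n
  have hnull : (Measure.pi fun _ : Fin n => μ) {α : Fin n → ℝ | ∀ i, |α i| ≤ R}ᶜ = 0 :=
    mem_ae_iff.mp hbox
  calc (Measure.pi fun _ : Fin n => μ) (andersonVectorLDSet μ E' ε n v)
      = (Measure.pi fun _ : Fin n => μ) (andersonVectorLDSet μ E' ε n v ∩ {α | ∀ i, |α i| ≤ R}) :=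
        (measure_inter_conull hnull).symm
    _ ≤ (Measure.pi fun _ : Fin n => μ) (andersonVectorLDSet μ E (ε / 2) n v) :=
        measure_mono (andersonVectorLDSet_inter_box_subset μ hR hDE hDE' hn v hv hL hρ)

end Literature.Probability.RandomMatrixProducts

end
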